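import Summits.MatrixMultiplication.OmegaCensus.STPPVosperSlackOneLawA2CoverSpec

/-!
# ω-census (abelian STPP census): a fast ROW CHECKER for the case-α₂ cover table, and its specification (kernel)

HONEST FRAMING (pub-omega census; verbatim): lottery ticket; floor = certified bounds/negative ranges.
Census STRUCTURE (seat pub-omega-stpp-1 gen 31, 2026-08-28), family (b2).  Feeds the hypothesis `hspecα` of
`no_isSTPP_of_slack_one_tables_prime_a2_coverSpec` (`STPPVosperSlackOneLawA2CoverSpec.lean`).  One row = one step ratio `j`; the configuration loops are
those of `tableAlpha2Cover`, but before the (kernel-expensive) `Finset` prefix law two CHEAP necessary conditions are tested on the LIST of window points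
(valid because the specification assumes that list duplicate-free): the least point is divisible by `r` (it has rank `0`), and the largest point minus
`L + 1` is divisible by `r` (it has rank `L + 1`); then the prefix law itself is evaluated on the list (`prefixOKL`, rank = length of the filtered list),
and only then the exact-cover search.  `a2CoverRow_spec` turns `a2CoverRow … j = true` into the `j`-th instance of `hspecα`.  Rows are `decide`d in
separate files and assembled in the kill file.  Pure finite bookkeeping; nothing here is progress on `ω`.
-/

open Finset

namespace Summit.MatrixMultiplication.OmegaCensus.CubeNB

/-! ## List helpers -/

/-- `l.foldl min a` is at most the seed and at most every element. [folklore] -/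
theorem foldl_min_le (l : List ℕ) : ∀ a : ℕ, l.foldl min a ≤ a ∧ ∀ x ∈ l, l.foldl min a ≤ x := by
  induction l with
  | nil => intro a; simp
  | cons y l ih =>
    intro a
    rw [List.foldl_cons]
    obtain ⟨h1, h2⟩ := ih (min a y)
    refine ⟨h1.trans (Nat.min_le_left a y), fun x hx => ?_⟩
    rw [List.mem_cons] at hx
    rcases hx with rfl | hx
    · exact h1.trans (Nat.min_le_right a x)
    · exact h2 x hx

/-- `l.foldl min a` is the seed or an element of the list. [folklore] -/
theorem foldl_min_mem (l : List ℕ) : ∀ a : ℕ, l.foldl min a = a ∨ l.foldl min a ∈ l := by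
  induction l with
  | nil => intro a; simp
  | cons y l ih =>
    intro a
    rw [List.foldl_cons]
    rcases ih (min a y) with h | h
    · rw [h]
      rcases Nat.le_total a y with hay | hya
      · left; exact Nat.min_eq_left hay
      · right; rw [Nat.min_eq_right hya]; exact List.mem_cons_self
    · right; exact List.mem_cons_of_mem y h

/-- `l.foldl max a` is at least the seed and at least every element. [folklore] -/
theorem le_foldl_max (l : List ℕ) : ∀ a : ℕ, a ≤ l.foldl max a ∧ ∀ x ∈ l, x ≤ l.foldl max a := by
  induction l with
  | nil => intro a; simp
  | cons y l ih =>
    intro a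
    rw [List.foldl_cons]
    obtain ⟨h1, h2⟩ := ih (max a y)
    refine ⟨(Nat.le_max_left a y).trans h1, fun x hx => ?_⟩
    rw [List.mem_cons] at hx
    rcases hx with rfl | hx
    · exact (Nat.le_max_right a x).trans h1
    · exact h2 x hx

/-- `l.foldl max a` is the seed or an element of the list. [folklore] -/
theorem foldl_max_mem (l : List ℕ) : ∀ a : ℕ, l.foldl max a = a ∨ l.foldl max a ∈ l := by
  induction l with
  | nil => intro a; simp
  | cons y l ih =>
    intro a
    rw [List.foldl_cons]
    rcases ih (max a y) with h | h
    · rw [h]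
      rcases Nat.le_total y a with hya | hay
      · left; exact Nat.max_eq_left hya
      · right; rw [Nat.max_eq_right hay]; exact List.mem_cons_self
    · right; exact List.mem_cons_of_mem y h

/-- The prefix law on a LIST: every `x ∈ l` has `r ∣ x − #[y ∈ l, y < x]` (agrees with `prefixOK r l.toFinset` when `l` is duplicate-free).
[folklore] -/
def prefixOKL (r : ℕ) (l : List ℕ) : Bool :=
  l.all fun x => decide (r ∣ x - (l.filter fun y => decide (y < x)).length)

/-! ## The row checker -/

/-- **One row (`j` fixed) of the case-α₂ cover table, fast form** (`Bool`): window tests, then on the window point list `l` the pre-tests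
`r ∣ min l` and `r ∣ max l − (L + 1)` (seeded `foldl`s), then the list prefix law, then the exact-cover search. [folklore] -/
def a2CoverRow (p n₁ L r : ℕ) (J : Finset ℕ) (z : ℕ) (blocks : List (ℕ × ℕ × ℕ)) (j : ℕ) : Bool :=
  decide (j ∈ J) || (List.range L).all fun ℓ₁ => (ℓ₁ == 0) || !(decide (2 * ℓ₁ ≤ L)) ||
    (List.range p).all fun t₁ => !((List.range (ℓ₁ + 1)).all fun i => decide ((t₁ + j * i) % p < n₁)) ||
      (List.range p).all fun t₂ => !((List.range (L - ℓ₁ + 1)).all fun i => decide ((t₂ + j * i) % p < n₁)) ||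
        !(decide (r ∣ (windowList p j ℓ₁ L t₁ t₂).foldl min (t₁ % p))) ||
        !(decide (r ∣ (windowList p j ℓ₁ L t₁ t₂).foldl max (t₁ % p) - (L + 1))) ||
        !(prefixOKL r (windowList p j ℓ₁ L t₁ t₂)) ||
        !(existsCover p z (coverYL p j ℓ₁ L t₁ t₂) blocks [] [])

/-! ## Specification -/

/-- The window point list enumerates the `Finset` of the table. [folklore] -/
theorem mem_windowList_iff {p j ℓ₁ L t₁ t₂ x : ℕ} :
    x ∈ windowList p j ℓ₁ L t₁ t₂ ↔
      x ∈ (range (ℓ₁ + 1)).image (fun i => (t₁ + j * i) % p) ∪ (range (L - ℓ₁ + 1)).image (fun i => (t₂ + j * i) % p) := by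
  rw [windowList, List.mem_append, Finset.mem_union, List.mem_map, List.mem_map, Finset.mem_image, Finset.mem_image]
  simp only [List.mem_range, Finset.mem_range]

/-- `t₁ mod p` (the `i = 0` point) is in the window point list. [folklore] -/
theorem seed_mem_windowList (p j ℓ₁ L t₁ t₂ : ℕ) : t₁ % p ∈ windowList p j ℓ₁ L t₁ t₂ := by
  rw [windowList, List.mem_append]
  exact Or.inl (List.mem_map.2 ⟨0, List.mem_range.2 (by omega), by simp⟩)

/-- For a duplicate-free list and its `Finset`, the rank below `x` agrees: `#(S.filter (· < x)) = (l.filter (· < x)).length`. [folklore] -/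
theorem card_filter_lt_eq_length {l : List ℕ} (hl : l.Nodup) {S : Finset ℕ} (hS : ∀ y, y ∈ l ↔ y ∈ S) (x : ℕ) :
    #(S.filter fun y => y < x) = (l.filter fun y => decide (y < x)).length := by
  have hnd : (l.filter fun y => decide (y < x)).Nodup := hl.filter _
  rw [← List.toFinset_card_of_nodup hnd]
  congr 1
  ext y
  simp only [Finset.mem_filter, List.mem_toFinset, List.mem_filter, decide_eq_true_eq, hS]

/-- **Specification of the row checker.**  If `a2CoverRow p n₁ L r J z blocks j = true` then for every configuration of row `j` passing the
window tests, with duplicate-free window point list satisfying the (`Finset`) prefix law, `j ∈ J` or the cover search fails — the `j`-th instance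
of the hypothesis `hspecα` of `no_isSTPP_of_slack_one_tables_prime_a2_coverSpec`. [folklore] -/
theorem a2CoverRow_spec {p n₁ L r : ℕ} {J : Finset ℕ} {z : ℕ} {blocks : List (ℕ × ℕ × ℕ)} {j : ℕ}
    (h : a2CoverRow p n₁ L r J z blocks j = true) :
    ∀ ℓ₁, 1 ≤ ℓ₁ → 2 * ℓ₁ ≤ L → ∀ t₁ < p, ∀ t₂ < p, (∀ i < ℓ₁ + 1, (t₁ + j * i) % p < n₁) →
      (∀ i < L - ℓ₁ + 1, (t₂ + j * i) % p < n₁) → (windowList p j ℓ₁ L t₁ t₂).Nodup →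
      prefixOK r ((range (ℓ₁ + 1)).image (fun i => (t₁ + j * i) % p) ∪ (range (L - ℓ₁ + 1)).image (fun i => (t₂ + j * i) % p)) = true →
      j ∈ J ∨ existsCover p z (coverYL p j ℓ₁ L t₁ t₂) blocks [] [] = false := by
  intro ℓ₁ hℓ1 hℓ2 t₁ ht₁ t₂ ht₂ hw1 hw2 hnd hpre
  rw [a2CoverRow, Bool.or_eq_true, decide_eq_true_eq, List.all_eq_true] at h
  rcases h with hJ | h
  · exact Or.inl hJ
  right
  have h2 := h ℓ₁ (List.mem_range.2 (by omega))
  rw [Bool.or_eq_true, Bool.or_eq_true, List.all_eq_true] at h2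
  rcases h2 with (h3 | h3) | h3
  · rw [beq_iff_eq] at h3; omega
  · rw [Bool.not_eq_true', decide_eq_false_iff_not] at h3; exact absurd hℓ2 h3
  have h4 := h3 t₁ (List.mem_range.2 ht₁)
  rw [Bool.or_eq_true, Bool.not_eq_true', List.all_eq_true] at h4
  rcases h4 with h5 | h5
  · rw [Bool.eq_false_iff] at h5
    exfalso; apply h5
    rw [List.all_eq_true]
    intro i hi
    rw [decide_eq_true_eq]
    exact hw1 i (List.mem_range.1 hi)
  have h6 := h5 t₂ (List.mem_range.2 ht₂)
  -- the facts behind the cheap tests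
  set l := windowList p j ℓ₁ L t₁ t₂ with hl
  set PS := (range (ℓ₁ + 1)).image (fun i => (t₁ + j * i) % p) ∪ (range (L - ℓ₁ + 1)).image (fun i => (t₂ + j * i) % p) with hPS
  have hmem : ∀ y, y ∈ l ↔ y ∈ PS := fun y => mem_windowList_iff
  have hpre' : ∀ x ∈ PS, r ∣ x - #(PS.filter fun y => y < x) := by
    rw [prefixOK, decide_eq_true_eq] at hpre; exact hpre
  have hrank : ∀ x, #(PS.filter fun y => y < x) = (l.filter fun y => decide (y < x)).length :=
    fun x => card_filter_lt_eq_length hnd hmem x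
  have hseed : t₁ % p ∈ l := seed_mem_windowList p j ℓ₁ L t₁ t₂
  -- minimum
  have hmin : r ∣ l.foldl min (t₁ % p) := by
    set m := l.foldl min (t₁ % p) with hm
    have hml : m ∈ l := by
      rcases foldl_min_mem l (t₁ % p) with h0 | h0
      · rw [hm, h0]; exact hseed
      · exact h0
    have hx := hpre' m ((hmem m).1 hml)
    have hempty : PS.filter (fun y => y < m) = ∅ := by
      rw [Finset.filter_eq_empty_iff]
      intro y hy hlt
      exact absurd ((foldl_min_le l (t₁ % p)).2 y ((hmem y).2 hy)) (by omega)
    rwa [hempty, Finset.card_empty, Nat.sub_zero] at hx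
  -- maximum: its rank is `length − 1 = L + 1`
  have hlen : l.length = L + 2 := by
    rw [hl, windowList, List.length_append, List.length_map, List.length_map, List.length_range, List.length_range]; omega
  have hmax : r ∣ l.foldl max (t₁ % p) - (L + 1) := by
    set M := l.foldl max (t₁ % p) with hM
    have hMl : M ∈ l := by
      rcases foldl_max_mem l (t₁ % p) with h0 | h0
      · rw [hM, h0]; exact hseed
      · exact h0
    have hx := hpre' M ((hmem M).1 hMl)
    rw [hrank] at hx
    -- the elements below `M` are all elements but `M`
    have hle : ∀ y ∈ l, y ≤ M := (le_foldl_max l (t₁ % p)).2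
    have hsplit : l.length = (l.filter fun y => decide (y < M)).length + (l.filter fun x => !decide (x < M)).length :=
      List.length_eq_length_filter_add _
    have hge : (l.filter fun y => !decide (y < M)) = l.filter fun y => decide (y = M) := by
      apply List.filter_congr
      intro y hy
      have := hle y hy
      by_cases hyM : y = M
      · simp [hyM]
      · have : y < M := lt_of_le_of_ne this hyM
        simp [this, hyM]
    have hone : (l.filter fun y => decide (y = M)).length = 1 := by
      have hnd' := hnd.filter (fun y => decide (y = M))
      have hall : ∀ y ∈ l.filter (fun y => decide (y = M)), y = M := fun y hy => by
        have := (List.mem_filter.1 hy).2; simpa using this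
      have hMin : M ∈ l.filter (fun y => decide (y = M)) := List.mem_filter.2 ⟨hMl, by simp⟩
      rcases hF : l.filter (fun y => decide (y = M)) with _ | ⟨y, _ | ⟨y', rest⟩⟩
      · rw [hF] at hMin; simp at hMin
      · rfl
      · exfalso
        rw [hF] at hall hnd'
        have e1 := hall y (by simp)
        have e2 := hall y' (by simp)
        rw [e1, e2, List.nodup_cons] at hnd'
        exact hnd'.1 List.mem_cons_self
    rw [hge, hone, hlen] at hsplit
    rwa [show (l.filter fun y => decide (y < M)).length = L + 1 by omega] at hx
  -- list prefix law
  have hpreL : prefixOKL r l = true := by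
    rw [prefixOKL, List.all_eq_true]
    intro x hx
    rw [decide_eq_true_eq, ← hrank]
    exact hpre' x ((hmem x).1 hx)
  -- read off the row
  rw [Bool.or_eq_true, Bool.or_eq_true, Bool.or_eq_true, Bool.or_eq_true, Bool.not_eq_true', Bool.not_eq_true', Bool.not_eq_true',
    Bool.not_eq_true', Bool.not_eq_true'] at h6
  rcases h6 with (((h7 | h7) | h7) | h7) | h7
  · rw [Bool.eq_false_iff] at h7
    exfalso; apply h7
    rw [List.all_eq_true]
    intro i hi
    rw [decide_eq_true_eq]
    exact hw2 i (List.mem_range.1 hi)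
  · rw [decide_eq_false_iff_not] at h7; exact absurd hmin h7
  · rw [decide_eq_false_iff_not] at h7; exact absurd hmax h7
  · rw [hpreL] at h7; exact Bool.noConfusion h7
  · exact h7

end Summit.MatrixMultiplication.OmegaCensus.CubeNB
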